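/-
Copyright (c) 2026. All rights reserved.
Released under Apache 2.0 license as described in the file LICENSE.
-/
import Literature.NumberTheory.Automorphic.QuaternionicSIdealClassesHecke
import Literature.NumberTheory.Automorphic.BrandtModuleEisensteinCuspidalHecke
import HarnessLib

/-!
# Weights and sizes of the quaternionic `T`-ideal classes: `m(O) = ∑_X n_X / w_X`, the weighted symmetry
# `n_X w_X B_T(n)_{XY} = n_Y w_Y B_T(n)_{YX}` of the `T`-class Brandt matrices, and their Eisenstein vector
# (Martin 2018, Lemma 4 and §5.3: `(𝟙, 𝟙) = ∑_j c_j^{-1} n_j` is Eichler's mass)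

[tag: quaternion_algebra] [tag: eichler_order] [tag: hecke_operator]

Topic `NumberTheory/Automorphic`. Lane `lit-hodgefound`, seat p12, gen 52 — sequel of `QuaternionicSIdealClassesHecke.lean`
(`B_T(n)`, `T(n)(g ∘ π) = (B_T(n) g) ∘ π`) and `BrandtModuleEisensteinCuspidalHecke.lean` (`T(n) e₀ = σ₁(n) e₀`,
`deg ∘ T(n) = σ₁(n) deg`).

[Martin2018, Lemma 4]: "`O_l([x]) = O_l(σ_𝔭([x]))` and `Γ([x]) = Γ(σ_𝔭([x]))`" — the unit group, hence the Brandt weight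
`w`, is constant on each `T`-class; [Martin2018, §5.3 (proof of Prop. 15)]: "for a fixed `X_j` the coefficients
`|𝔬_F^×|/|Γ_i|` appearing in (3.1) are identical for all `i` with `x_i ∈ X_j`. Let `c_j` be this number … `n_j = |X_j|` …
`(𝟙, 𝟙) = ∑_i |𝔬_F^×|/|Γ_i| = ∑_j c_j^{-1} n_j`. This number is the mass `m(O)` of `O` studied by Eichler." For a Brandt
setup `S`, a finite `T` and a `T`-class `X ∈ Cl_T(O)` with SIZE `n_X = #X` (`XiSetup.sClassSize`) and WEIGHT `w_X`
(`XiSetup.sClassWeight`, the common weight of its members):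

* §1 `weight_eq_of_sClassOf_eq` (Lemma 4), `sClassWeight_eq`, `one_le_sClassWeight`, `sClassSize_eq_card_filter`,
  `sClassSize_pos`, `sClassSize_mul_natCard_stabilizer` (`n_X · #Stab = 2^{#T}`), **`sum_sClassSize`** (`∑_X n_X = h`),
  `sum_fiber_eq_sClassSize_mul` (a class function sums to `n_X · value`);
* §2 ★ **`sum_inv_weight_eq_sum_sClassSize_div_sClassWeight`** (`∑_c 1/w_c = ∑_X n_X / w_X`: Eichler's mass through the
  `T`-classes, Martin's `(𝟙, 𝟙) = ∑_j c_j^{-1} n_j`), `degree_comp_sClassOf` (`deg (g ∘ π) = ∑_X n_X g(X)`);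
* §3 ★ **`sClassSize_mul_sClassWeight_mul_sClassMatrix_symm`** (`n_X w_X B_T(n)_{XY} = n_Y w_Y B_T(n)_{YX}`: the `T`-class
  Brandt matrices are self-adjoint for `⟨δ_X, δ_Y⟩ = n_X w_X δ_{XY}`, from `w_c T(n)_{cc'} = w_{c'} T(n)_{c'c}`);
* §4 **`map_sClassMatrix_mulVec_inv_sClassWeight`** (`B_T(n) (1/w_X)_X = σ₁(n) (1/w_X)_X`, `n` prime to `N⁺N⁻`: the
  Eisenstein vector of `Cl_T(O)`), **`sum_sClassSize_mul_map_sClassMatrix_mulVec`**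
  (`∑_X n_X (B_T(n) g)_X = σ₁(n) ∑_X n_X g_X`).

## References

* [Martin2018] K. Martin, *Congruences for modular forms mod 2 and quaternionic `S`-ideal classes*, Canad. J. Math. 70
  (2018) (held: arXiv 1701.07864): §4.1 Lemma 4, §3.1 (3.1), §5.3.
* [Gross1987] B. H. Gross, *Heights and the special values of L-series*, CMS Conf. Proc. 7 (1987), §1 (`w_i`, `e₀`,
  `⟨e_i, e_j⟩ = w_i δ_ij`, mass `∑ 1/w_i`).
* [PollackWeston2011] R. Pollack, T. Weston, Compos. Math. 147 (2011), §2.1 (weight symmetry of the Brandt matrices).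

## Scope (honest)

Weight `0`, `F = ℚ`; Eichler's closed formula for the mass is not restated here (only its decomposition over `Cl_T(O)`).
Two definitions (`sClassSize`, `sClassWeight`), theorems otherwise; no named fact, no instance.
-/

noncomputable section

open scoped Pointwise Matrix
open ArithmeticFunction

namespace Literature.NumberTheory.Automorphic

namespace Brandt

variable {Nplus Nminus : ℕ} (S : XiSetup Nplus Nminus) (T : Finset ℕ)

/-! ## §1 Weights and sizes of `T`-classes -/

/-- **Lemma 4: the Brandt weight is constant on each `T`-class** (`Γ([x]) = Γ(σ_𝔭([x]))`: the involutions preserve the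
left order up to isomorphism). [cite: Martin2018, §4.1 Lemma 4] -/
theorem XiSetup.weight_eq_of_sClassOf_eq {c c' : ClassSet S.O} (h : S.sClassOf T c = S.sClassOf T c') :
    weight S.O c = weight S.O c' :=
  weight_eq_weight_of_typeOf_eq (S.typeOf_eq_of_sClassOf_eq T h)

/-- **The weight `w_X` of a `T`-class** (`w_c` for any `c ∈ X`; Martin's `|Γ(X)|/|𝔬_F^×|`, the inverse of his `c_j`).
[cite: Martin2018, §4.1 Lemma 4 and §5.3 (`c_j`)] [cite: Gross1987, §1 (`w_i`)] -/
def XiSetup.sClassWeight (T : Finset ℕ) (X : S.SClassSet T) : ℕ := weight S.O (S.sClassOf_surjective T X).choose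

/-- `w_X = w_c` for every `c ∈ X`. [cite: Martin2018, §4.1 Lemma 4] -/
theorem XiSetup.sClassWeight_eq {c : ClassSet S.O} {X : S.SClassSet T} (hc : S.sClassOf T c = X) :
    S.sClassWeight T X = weight S.O c :=
  S.weight_eq_of_sClassOf_eq T (((S.sClassOf_surjective T X).choose_spec).trans hc.symm)

/-- `w_X ≥ 1`. [cite: Gross1987, §1] -/
theorem XiSetup.one_le_sClassWeight (X : S.SClassSet T) : 1 ≤ S.sClassWeight T X := by
  obtain ⟨c, hc⟩ := S.sClassOf_surjective T X
  rw [S.sClassWeight_eq T hc]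
  exact S.one_le_weight c

/-- **The size `n_X = #X` of a `T`-class.** [cite: Martin2018, §5.3 (`n_j = |X_j|`)] -/
def XiSetup.sClassSize (T : Finset ℕ) (X : S.SClassSet T) : ℕ := Nat.card {c : ClassSet S.O // S.sClassOf T c = X}

/-- Unfolding `n_X`. [cite: Martin2018, §5.3] -/
theorem XiSetup.sClassSize_eq (X : S.SClassSet T) : S.sClassSize T X = Nat.card {c : ClassSet S.O // S.sClassOf T c = X} :=
  rfl

open Classical in
/-- `n_X` as the cardinality of a fibre of `π : Cls O → Cl_T(O)`. [cite: Martin2018, §5.3] -/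
theorem XiSetup.sClassSize_eq_card_filter [Fintype (ClassSet S.O)] (X : S.SClassSet T) :
    S.sClassSize T X = (Finset.univ.filter fun c : ClassSet S.O => S.sClassOf T c = X).card := by
  rw [S.sClassSize_eq, Nat.card_eq_fintype_card, Fintype.card_subtype]

/-- `n_X ≥ 1`. [cite: Martin2018, §5.3] -/
theorem XiSetup.sClassSize_pos (X : S.SClassSet T) : 0 < S.sClassSize T X := by
  obtain ⟨c, hc⟩ := S.sClassOf_surjective T X
  rw [S.sClassSize_eq]
  haveI : Nonempty {c : ClassSet S.O // S.sClassOf T c = X} := ⟨⟨c, hc⟩⟩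
  exact Nat.card_pos

/-- **Orbit–stabiliser: `n_X · #Stab(c) = 2^{#T}`** (`c ∈ X`). [cite: Martin2018, §2 (`h_{B,S} ≥ 2^{-|S|} h_B`)] -/
theorem XiSetup.sClassSize_mul_natCard_stabilizer {c : ClassSet S.O} {X : S.SClassSet T} (hc : S.sClassOf T c = X) :
    S.sClassSize T X * Nat.card {g : T → Multiplicative (ZMod 2) // S.atkinLehnerHom T g c = c} = 2 ^ T.card := by
  rw [S.sClassSize_eq, ← hc]
  exact S.natCard_sClass_mul_natCard_stabilizer T c

/-- `n_X ∣ 2^{#T}`. [cite: Martin2018, §2] -/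
theorem XiSetup.sClassSize_dvd_two_pow (X : S.SClassSet T) : S.sClassSize T X ∣ 2 ^ T.card := by
  obtain ⟨c, hc⟩ := S.sClassOf_surjective T X
  exact Dvd.intro _ (S.sClassSize_mul_natCard_stabilizer T hc)

open Classical in
/-- A function of the `T`-class sums over a fibre to `n_X` times its value. [folklore] -/
private theorem sum_filter_const [Fintype (ClassSet S.O)] {α : Type*} [AddCommMonoid α] (X : S.SClassSet T) (a : α) :
    ∑ _c ∈ Finset.univ.filter (fun c : ClassSet S.O => S.sClassOf T c = X), a = S.sClassSize T X • a := by
  rw [Finset.sum_const, S.sClassSize_eq_card_filter]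

/-- **`∑_X n_X = h`.** [cite: Martin2018, §5.3] -/
theorem XiSetup.sum_sClassSize [Fintype (ClassSet S.O)] [Fintype (S.SClassSet T)] :
    ∑ X, S.sClassSize T X = Nat.card (ClassSet S.O) := by
  classical
  rw [Nat.card_eq_fintype_card, ← Finset.card_univ, Finset.card_eq_sum_ones,
    ← Finset.sum_fiberwise Finset.univ (S.sClassOf T) fun _ => 1]
  refine Finset.sum_congr rfl fun X _ => ?_
  rw [sum_filter_const S T X (1 : ℕ), smul_eq_mul, mul_one]

/-- `∑_c f(π c) = ∑_X n_X f(X)` for a function `f` on `Cl_T(O)`. [cite: Martin2018, §5.3] -/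
theorem XiSetup.sum_comp_sClassOf_eq [Fintype (ClassSet S.O)] [Fintype (S.SClassSet T)] {α : Type*} [AddCommMonoid α]
    (f : S.SClassSet T → α) : ∑ c, f (S.sClassOf T c) = ∑ X, S.sClassSize T X • f X := by
  classical
  rw [← Finset.sum_fiberwise Finset.univ (S.sClassOf T) fun c => f (S.sClassOf T c)]
  refine Finset.sum_congr rfl fun X _ => ?_
  rw [Finset.sum_congr rfl fun c hc => by rw [(Finset.mem_filter.mp hc).2], sum_filter_const S T X]

/-! ## §2 The mass through the `T`-classes -/

/-- **`∑_c 1/w_c = ∑_X n_X / w_X`**: Eichler's mass `m(O)` decomposed over Martin's `T`-classes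
("`(𝟙, 𝟙) = ∑_i |𝔬_F^×|/|Γ_i| = ∑_j c_j^{-1} n_j` … is the mass `m(O)`"). [cite: Martin2018, §5.3] [cite: Gross1987, §1 (1.2)] -/
theorem XiSetup.sum_inv_weight_eq_sum_sClassSize_div_sClassWeight [Fintype (ClassSet S.O)] [Fintype (S.SClassSet T)] :
    ∑ c : ClassSet S.O, ((weight S.O c : ℚ))⁻¹ = ∑ X, (S.sClassSize T X : ℚ) / (S.sClassWeight T X : ℚ) := by
  have h := S.sum_comp_sClassOf_eq T fun X => ((S.sClassWeight T X : ℚ))⁻¹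
  simp only [nsmul_eq_mul, ← div_eq_mul_inv] at h
  rw [← h]
  exact Finset.sum_congr rfl fun c _ => by rw [S.sClassWeight_eq T rfl]

/-- **`deg (g ∘ π) = ∑_X n_X g(X)`.** [cite: Martin2018, §5.3] [cite: Gross1987, §1 (`deg`)] -/
theorem XiSetup.degree_comp_sClassOf [Fintype (ClassSet S.O)] [Fintype (S.SClassSet T)] (g : S.SClassSet T → ℚ) :
    S.degree (g ∘ S.sClassOf T) = ∑ X, (S.sClassSize T X : ℚ) * g X := by
  rw [S.degree_apply]
  simp only [Function.comp_apply, S.sum_comp_sClassOf_eq T g, nsmul_eq_mul]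

/-! ## §3 Weighted symmetry of the `T`-class Brandt matrices -/

open Classical in
/-- **`n_X w_X B_T(n)_{XY} = n_Y w_Y B_T(n)_{YX}`**: the `T`-class Brandt matrices are self-adjoint for the pairing
`⟨δ_X, δ_Y⟩ = n_X w_X δ_{XY}` (the restriction of Gross's `⟨e_c, e_{c'}⟩ = w_c δ_{cc'}` to the pulled-back class
functions), from `w_c T(n)_{cc'} = w_{c'} T(n)_{c'c}`. [cite: Gross1987, §1] [cite: PollackWeston2011, §2.1] [cite: Martin2018, §3.1 (3.1) and §3.3 (3.8)] -/
theorem XiSetup.sClassSize_mul_sClassWeight_mul_sClassMatrix_symm [Fintype (ClassSet S.O)] (n : ℕ) (X Y : S.SClassSet T) :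
    (S.sClassSize T X : ℤ) * (S.sClassWeight T X : ℤ) * S.sClassMatrix T n X Y =
      (S.sClassSize T Y : ℤ) * (S.sClassWeight T Y : ℤ) * S.sClassMatrix T n Y X := by
  -- both sides equal `∑_{c ∈ X} ∑_{c' ∈ Y} w_c T(n)_{c c'}`
  have hX : (S.sClassSize T X : ℤ) * (S.sClassWeight T X : ℤ) * S.sClassMatrix T n X Y =
      ∑ c ∈ Finset.univ.filter (fun c : ClassSet S.O => S.sClassOf T c = X),
        ∑ c' ∈ Finset.univ.filter (fun c' : ClassSet S.O => S.sClassOf T c' = Y), (weight S.O c : ℤ) * matrix S.O n c c' := by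
    rw [Finset.sum_congr rfl fun c hc => by
      rw [← Finset.mul_sum, ← S.sClassMatrix_eq_sum T n (Finset.mem_filter.mp hc).2 Y,
        ← S.sClassWeight_eq T (Finset.mem_filter.mp hc).2]]
    rw [sum_filter_const S T X, nsmul_eq_mul, mul_assoc]
  have hY : (S.sClassSize T Y : ℤ) * (S.sClassWeight T Y : ℤ) * S.sClassMatrix T n Y X =
      ∑ c' ∈ Finset.univ.filter (fun c' : ClassSet S.O => S.sClassOf T c' = Y),
        ∑ c ∈ Finset.univ.filter (fun c : ClassSet S.O => S.sClassOf T c = X), (weight S.O c' : ℤ) * matrix S.O n c' c := by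
    rw [Finset.sum_congr rfl fun c' hc' => by
      rw [← Finset.mul_sum, ← S.sClassMatrix_eq_sum T n (Finset.mem_filter.mp hc').2 X,
        ← S.sClassWeight_eq T (Finset.mem_filter.mp hc').2]]
    rw [sum_filter_const S T Y, nsmul_eq_mul, mul_assoc]
  rw [hX, hY, Finset.sum_comm]
  exact Finset.sum_congr rfl fun c' _ => Finset.sum_congr rfl fun c _ => S.weight_mul_matrix_symm n c c'

/-! ## §4 The Eisenstein vector and the degree on `Cl_T(O)` -/

/-- **`B_T(n) (1/w_X)_X = σ₁(n) (1/w_X)_X`** for `n ≥ 1` prime to `N⁺N⁻`: the pull-back of `(1/w_X)_X` is Gross's `e₀`.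
[cite: Gross1987, §1–§2] [cite: Martin2018, §3.3 (`𝟙 ∈ M^{+_𝔐}`, `T_𝔭 𝟙 = (N𝔭 + 1) 𝟙`)] -/
theorem XiSetup.map_sClassMatrix_mulVec_inv_sClassWeight [Fintype (ClassSet S.O)] [DecidableEq (ClassSet S.O)]
    [Fintype (S.SClassSet T)] {n : ℕ} (hn : n ≠ 0) (hcop : Nat.Coprime n (Nplus * Nminus)) :
    (S.sClassMatrix T n).map (Int.cast : ℤ → ℚ) *ᵥ (fun X => ((S.sClassWeight T X : ℚ))⁻¹) =
      ((sigma 1 n : ℕ) : ℚ) • fun X => ((S.sClassWeight T X : ℚ))⁻¹ := by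
  rw [S.mulVec_eq_smul_iff_comp_sClassOf T n]
  have he : (fun X => ((S.sClassWeight T X : ℚ))⁻¹) ∘ S.sClassOf T = fun c => ((weight S.O c : ℚ))⁻¹ := by
    funext c
    rw [Function.comp_apply, S.sClassWeight_eq T rfl]
  rw [he, ← Matrix.toLin'_apply, S.toLin_matrix_inv_weight hn hcop]

/-- **`∑_X n_X (B_T(n) g)_X = σ₁(n) ∑_X n_X g_X`** (`deg ∘ T(n) = σ₁(n) deg` pushed down to `Cl_T(O)`).
[cite: Gross1987, §1–§2] [cite: Martin2018, §3.3 (3.8)] -/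
theorem XiSetup.sum_sClassSize_mul_map_sClassMatrix_mulVec [Fintype (ClassSet S.O)] [DecidableEq (ClassSet S.O)]
    [Fintype (S.SClassSet T)] {n : ℕ} (hn : n ≠ 0) (hcop : Nat.Coprime n (Nplus * Nminus)) (g : S.SClassSet T → ℚ) :
    ∑ X, (S.sClassSize T X : ℚ) * ((S.sClassMatrix T n).map (Int.cast : ℤ → ℚ) *ᵥ g) X =
      ((sigma 1 n : ℕ) : ℚ) * ∑ X, (S.sClassSize T X : ℚ) * g X := by
  rw [← S.degree_comp_sClassOf T, ← S.degree_comp_sClassOf T g, ← S.map_mulVec_comp_sClassOf T n g,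
    ← Matrix.toLin'_apply, S.degree_toLin_matrix hn hcop]

end Brandt

end Literature.NumberTheory.Automorphic
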